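import Summits.NavierStokesRegularity.NavierStokesRegularity.Theorems.EfficiencyFloorNearSaturationNearMaximiserSeqCoreHeatFatou
import HarnessLib

/-!
# Route `EfficiencyFloor`, crux `NearSaturationNearMaximiser` (stmt-NavierStokesRegularity-25482) on the
# `ProductionEfficiencyDecay` ladder (stmt-22866): THE UNIFORM-IN-TIME MOLLIFICATION BOUND (HMa) — last d-free hypothesis discharged

Def-free helper file, twentieth of the group. PROVES (HMa) of `nearSaturationNearMaximiser_of_uniformMollification_of_identification`
(`…SeqCoreHeatFatou`): for a `C¹` field `g` with `g, Dg ∈ L²` and `0 < a ≤ t`,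
`∫‖e^{tΔ}g − e^{aΔ}g‖² ≤ 288 · t · ∫‖Dg‖²`. Proof: `e^{tΔ}g − e^{aΔ}g = ∫ₐᵗ Δe^{σΔ}g dσ` (`heatExtension_sub_eq_integral_laplacian`);
WEIGHTED Cauchy–Schwarz in `σ`: `|∫ₐᵗF|² ≤ (∫ₐᵗσ^{-1/2})(∫ₐᵗσ^{1/2}|F_σ|²)`; Tonelli in `(σ, x)` (`lintegral_lintegral_swap`, joint continuity
`continuousOn_uncurry_laplacian_heatExtension_of_memLp`); the smoothing bound `∫‖Δe^{σΔ}g‖² ≤ 72σ⁻¹∫‖Dg‖²` (`…SeqCoreHeatLaplacian`);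
`∫ₐᵗ σ^{-1/2} ≤ 2√t`. With this file the by-name reduction of stmt-25482 depends on ONE hypothesis only: (I), the identification of the
weak-limit velocity gradient and the local vorticity limit of a centred normalised maximising subsequence with an ADMISSIBLE profile.

* `uniform_mollification_bound` — (HMa) with constant `288`;
* `nearSaturationNearMaximiser_of_identification` — BY NAME: stmt-25482 ⟸ (I).

HONEST FRAMING: (I) — existence, regularity and decay of the Lu–Doering extremising profile via a Sobolev-level profile decomposition —
is NOT proved; stmt-25482, `LerayFloorGap`, `ProductionEfficiencyDecay` (stmt-22866) and Navier–Stokes regularity stay OPEN; no summit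
statement is proved. [folklore]
-/

-- the problem directory repeats the summit name (`NavierStokesRegularity/NavierStokesRegularity`)
set_option linter.dupNamespace false

noncomputable section

namespace Summit.NavierStokesRegularity.NavierStokesRegularity.Theorems

namespace NearSaturationNearMaximiser

namespace SeqCore

open Set MeasureTheory Filter Topology Function Real
open scoped InnerProductSpace ENNReal NNReal Laplacian
open Literature.Analysis.UnboundedOperators

/-- `∫ₐᵗ σ^{-1/2} dσ = 2(√t − √a) ≤ 2√t` for `0 < a ≤ t` (set-integral form over `Ioc a t`). [folklore] -/
theorem setIntegral_rpow_neg_half_le {a t : ℝ} (ha : 0 < a) (hat : a ≤ t) :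
    IntegrableOn (fun σ : ℝ => σ ^ (-(1 / 2 : ℝ))) (Ioc a t) ∧ 0 ≤ ∫ σ in Ioc a t, σ ^ (-(1 / 2 : ℝ)) ∧
      ∫ σ in Ioc a t, σ ^ (-(1 / 2 : ℝ)) ≤ 2 * Real.sqrt t := by
  have hcont : ContinuousOn (fun σ : ℝ => σ ^ (-(1 / 2 : ℝ))) (Icc a t) := fun σ hσ =>
    (Real.continuousAt_rpow_const _ _ (Or.inl (by linarith [hσ.1]))).continuousWithinAt
  have hI : IntegrableOn (fun σ : ℝ => σ ^ (-(1 / 2 : ℝ))) (Ioc a t) := (hcont.integrableOn_Icc).mono_set Ioc_subset_Icc_self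
  refine ⟨hI, setIntegral_nonneg measurableSet_Ioc fun σ hσ => Real.rpow_nonneg (by linarith [hσ.1]) _, ?_⟩
  rw [← intervalIntegral.integral_of_le hat, integral_rpow (Or.inr ⟨by norm_num, by
    rw [uIcc_of_le hat]; exact fun h => by linarith [h.1]⟩)]
  have e : -(1 / 2 : ℝ) + 1 = 1 / 2 := by norm_num
  rw [e, ← Real.sqrt_eq_rpow, ← Real.sqrt_eq_rpow]
  have := Real.sqrt_nonneg a
  have : (Real.sqrt t - Real.sqrt a) / (1 / 2 : ℝ) = 2 * (Real.sqrt t - Real.sqrt a) := by ring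
  rw [this]; linarith

/-- **The uniform-in-time mollification bound (HMa)**: for a `C¹` field `g : ℝ³ → ℝ³` with `g, Dg ∈ L²` and `0 < a ≤ t`,
`∫‖e^{tΔ}g − e^{aΔ}g‖² ≤ 288 · t · ∫‖Dg‖²`. [folklore] -/
theorem uniform_mollification_bound {g : EuclideanSpace ℝ (Fin 3) → EuclideanSpace ℝ (Fin 3)} (hg : ContDiff ℝ 1 g)
    (I2 : Integrable (fun x => ‖g x‖ ^ 2)) (ID : Integrable (fun x => ‖fderiv ℝ g x‖ ^ 2)) {a t : ℝ} (ha : 0 < a) (hat : a ≤ t) :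
    ∫ x, ‖heatExtension g t x - heatExtension g a x‖ ^ 2 ≤ 288 * t * ∫ x, ‖fderiv ℝ g x‖ ^ 2 := by
  have ht : 0 < t := ha.trans_le hat
  have hg2 : MemLp g 2 volume := (memLp_two_iff_integrable_sq_norm hg.continuous.aestronglyMeasurable).2 I2
  set D : ℝ := ∫ x, ‖fderiv ℝ g x‖ ^ 2 with hD
  have hD0 : 0 ≤ D := integral_nonneg fun x => by positivity
  -- the time integrand `F σ x = Δ e^{σΔ} g (x)` (opaque through `hF`)
  obtain ⟨F, hF⟩ : ∃ F : ℝ → EuclideanSpace ℝ (Fin 3) → EuclideanSpace ℝ (Fin 3), ∀ σ x, F σ x = (Δ (heatExtension g σ)) x :=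
    ⟨_, fun _ _ => rfl⟩
  have hFcont : ∀ x, ContinuousOn (fun σ => F σ x) (Icc a t) := fun x => by
    have h := (continuousOn_laplacian_heatExtension_time hg2 one_le_two x).mono
      (show Icc a t ⊆ Ioi 0 from fun σ hσ => lt_of_lt_of_le ha hσ.1)
    exact h.congr fun σ _ => hF σ x
  -- (1) the time representation
  have hid : ∀ x, heatExtension g t x - heatExtension g a x = ∫ σ in Ioc a t, F σ x := fun x => by
    rw [heatExtension_sub_eq_integral_laplacian hg2 one_le_two ha hat x, intervalIntegral.integral_of_le hat]
    exact integral_congr_ae (ae_of_all _ fun σ => (hF σ x).symm)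
  -- (2) weighted Cauchy–Schwarz in time, pointwise in `x`
  obtain ⟨IA, hA0, hA⟩ := setIntegral_rpow_neg_half_le ha hat
  set A : ℝ := ∫ σ in Ioc a t, σ ^ (-(1 / 2 : ℝ)) with hAdef
  have hG_int : ∀ x, IntegrableOn (fun σ => σ ^ (1 / 2 : ℝ) * ‖F σ x‖ ^ 2) (Ioc a t) := fun x =>
    ((ContinuousOn.integrableOn_Icc ((continuousOn_id.rpow_const fun σ hσ => Or.inr (by norm_num)).mul
      ((hFcont x).norm.pow 2)))).mono_set Ioc_subset_Icc_self
  have hCS : ∀ x, ‖heatExtension g t x - heatExtension g a x‖ ^ 2 ≤ A * ∫ σ in Ioc a t, σ ^ (1 / 2 : ℝ) * ‖F σ x‖ ^ 2 := by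
    intro x
    -- `‖∫F‖ ≤ ∫‖F‖ = ∫ σ^{-1/4} (σ^{1/4}‖F‖) ≤ √A √G`
    have hFn : IntegrableOn (fun σ => F σ x) (Ioc a t) := ((hFcont x).integrableOn_Icc).mono_set Ioc_subset_Icc_self
    have hc1 : ContinuousOn (fun σ : ℝ => σ ^ (-(1 / 4 : ℝ))) (Icc a t) := fun σ hσ =>
      (Real.continuousAt_rpow_const _ _ (Or.inl (by linarith [hσ.1]))).continuousWithinAt
    have hc2 : ContinuousOn (fun σ : ℝ => σ ^ (1 / 4 : ℝ) * ‖F σ x‖) (Icc a t) :=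
      (continuousOn_id.rpow_const fun σ hσ => Or.inr (by norm_num)).mul (hFcont x).norm
    have m1 : MemLp (fun σ : ℝ => σ ^ (-(1 / 4 : ℝ))) 2 (volume.restrict (Ioc a t)) :=
      (memLp_two_iff_integrable_sq_norm (hc1.mono Ioc_subset_Icc_self |>.aestronglyMeasurable measurableSet_Ioc)).2
        (((hc1.norm.pow 2).integrableOn_Icc).mono_set Ioc_subset_Icc_self)
    have m2 : MemLp (fun σ : ℝ => σ ^ (1 / 4 : ℝ) * ‖F σ x‖) 2 (volume.restrict (Ioc a t)) :=
      (memLp_two_iff_integrable_sq_norm (hc2.mono Ioc_subset_Icc_self |>.aestronglyMeasurable measurableSet_Ioc)).2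
        (((hc2.norm.pow 2).integrableOn_Icc).mono_set Ioc_subset_Icc_self)
    have hH := integral_mul_le_Lp_mul_Lq_of_nonneg (μ := volume.restrict (Ioc a t)) Real.HolderConjugate.two_two
      (f := fun σ : ℝ => σ ^ (-(1 / 4 : ℝ))) (g := fun σ : ℝ => σ ^ (1 / 4 : ℝ) * ‖F σ x‖)
      ((ae_restrict_iff' measurableSet_Ioc).2 (ae_of_all _ fun σ hσ => Real.rpow_nonneg (by linarith [hσ.1]) _))
      ((ae_restrict_iff' measurableSet_Ioc).2 (ae_of_all _ fun σ hσ =>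
        mul_nonneg (Real.rpow_nonneg (by linarith [hσ.1]) _) (norm_nonneg _)))
      (by rw [ENNReal.ofReal_ofNat]; exact m1) (by rw [ENNReal.ofReal_ofNat]; exact m2)
    -- rewrite the three integrals
    have e0 : ∫ σ in Ioc a t, σ ^ (-(1 / 4 : ℝ)) * (σ ^ (1 / 4 : ℝ) * ‖F σ x‖) = ∫ σ in Ioc a t, ‖F σ x‖ :=
      setIntegral_congr_fun measurableSet_Ioc fun σ hσ => by
        have hσ0 : 0 < σ := lt_of_lt_of_le ha hσ.1.le
        rw [← mul_assoc, ← Real.rpow_add hσ0]; norm_num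
    have e1 : ∫ σ in Ioc a t, (σ ^ (-(1 / 4 : ℝ))) ^ (2 : ℝ) = A :=
      setIntegral_congr_fun measurableSet_Ioc fun σ hσ => by
        have hσ0 : 0 < σ := lt_of_lt_of_le ha hσ.1.le
        rw [← Real.rpow_mul hσ0.le]; norm_num
    have e2 : ∫ σ in Ioc a t, (σ ^ (1 / 4 : ℝ) * ‖F σ x‖) ^ (2 : ℝ) = ∫ σ in Ioc a t, σ ^ (1 / 2 : ℝ) * ‖F σ x‖ ^ 2 :=
      setIntegral_congr_fun measurableSet_Ioc fun σ hσ => by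
        have hσ0 : 0 < σ := lt_of_lt_of_le ha hσ.1.le
        rw [Real.rpow_two, mul_pow, ← Real.rpow_natCast (σ ^ (1 / 4 : ℝ)) 2, ← Real.rpow_mul hσ0.le]; norm_num
    rw [e0, e1, e2] at hH
    have hG0 : 0 ≤ ∫ σ in Ioc a t, σ ^ (1 / 2 : ℝ) * ‖F σ x‖ ^ 2 :=
      setIntegral_nonneg measurableSet_Ioc fun σ hσ => mul_nonneg (Real.rpow_nonneg (by linarith [hσ.1]) _) (sq_nonneg _)
    have hn : ‖heatExtension g t x - heatExtension g a x‖ ≤ ∫ σ in Ioc a t, ‖F σ x‖ := by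
      rw [hid x]; exact norm_integral_le_integral_norm _
    calc ‖heatExtension g t x - heatExtension g a x‖ ^ 2 ≤ (∫ σ in Ioc a t, ‖F σ x‖) ^ 2 :=
          pow_le_pow_left₀ (norm_nonneg _) hn 2
      _ ≤ (A ^ (1 / (2 : ℝ)) * (∫ σ in Ioc a t, σ ^ (1 / 2 : ℝ) * ‖F σ x‖ ^ 2) ^ (1 / (2 : ℝ))) ^ 2 :=
          pow_le_pow_left₀ (integral_nonneg fun σ => norm_nonneg _) hH 2
      _ = A * ∫ σ in Ioc a t, σ ^ (1 / 2 : ℝ) * ‖F σ x‖ ^ 2 := by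
          rw [mul_pow, ← Real.sqrt_eq_rpow, ← Real.sqrt_eq_rpow, Real.sq_sqrt hA0, Real.sq_sqrt hG0]
  -- (3) Tonelli and the smoothing bound
  have hmeas : AEMeasurable (uncurry fun (x : EuclideanSpace ℝ (Fin 3)) (σ : ℝ) => ENNReal.ofReal (σ ^ (1 / 2 : ℝ) * ‖F σ x‖ ^ 2))
      ((volume : Measure (EuclideanSpace ℝ (Fin 3))).prod ((volume : Measure ℝ).restrict (Ioc a t))) := by
    have hc : ContinuousOn (fun q : EuclideanSpace ℝ (Fin 3) × ℝ => ENNReal.ofReal (q.2 ^ (1 / 2 : ℝ) * ‖F q.2 q.1‖ ^ 2))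
        (univ ×ˢ Ioc a t) := by
      have hΔ : ContinuousOn (fun q : EuclideanSpace ℝ (Fin 3) × ℝ => F q.2 q.1) (univ ×ˢ Ioc a t) := by
        have h := (continuousOn_uncurry_laplacian_heatExtension_of_memLp hg2 one_le_two).comp continuous_swap.continuousOn
          (fun q (hq : q ∈ univ ×ˢ Ioc a t) => show q.swap ∈ Ioi (0 : ℝ) ×ˢ (univ : Set (EuclideanSpace ℝ (Fin 3))) from
            ⟨lt_of_lt_of_le ha hq.2.1.le, mem_univ _⟩)
        exact h.congr fun q _ => by simp [Function.comp, hF]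
      refine ENNReal.continuous_ofReal.comp_continuousOn ?_
      exact ((continuous_snd.continuousOn.rpow_const fun q hq => Or.inr (by norm_num))).mul (hΔ.norm.pow 2)
    have h := hc.aemeasurable (MeasurableSet.univ.prod measurableSet_Ioc)
      (μ := (volume : Measure (EuclideanSpace ℝ (Fin 3))).prod (volume : Measure ℝ))
    rw [← Measure.prod_restrict, Measure.restrict_univ] at h
    exact h
  have hinner : ∀ σ ∈ Ioc a t, ∫⁻ x, ENNReal.ofReal (σ ^ (1 / 2 : ℝ) * ‖F σ x‖ ^ 2) ≤ ENNReal.ofReal (72 * D * σ ^ (-(1 / 2 : ℝ))) := by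
    intro σ hσ
    have hσ0 : 0 < σ := lt_of_lt_of_le ha hσ.1.le
    obtain ⟨IΔ, hΔ⟩ := integral_norm_sq_laplacian_heatExtension_le hg I2 ID hσ0
    have IΔ' : Integrable (fun x => ‖F σ x‖ ^ 2) := IΔ.congr (ae_of_all _ fun x => by simp only [hF])
    have hΔ' : ∫ x, ‖F σ x‖ ^ 2 ≤ 72 * σ⁻¹ * D := by
      have e : ∫ x, ‖F σ x‖ ^ 2 = ∫ x, ‖(Δ (heatExtension g σ)) x‖ ^ 2 := integral_congr_ae (ae_of_all _ fun x => by simp only [hF])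
      rw [e]; exact hΔ
    calc ∫⁻ x, ENNReal.ofReal (σ ^ (1 / 2 : ℝ) * ‖F σ x‖ ^ 2)
        = ∫⁻ x, ENNReal.ofReal (σ ^ (1 / 2 : ℝ)) * ENNReal.ofReal (‖F σ x‖ ^ 2) :=
          lintegral_congr fun x => ENNReal.ofReal_mul (Real.rpow_nonneg hσ0.le _)
      _ = ENNReal.ofReal (σ ^ (1 / 2 : ℝ)) * ∫⁻ x, ENNReal.ofReal (‖F σ x‖ ^ 2) := lintegral_const_mul' _ _ ENNReal.ofReal_ne_top
      _ = ENNReal.ofReal (σ ^ (1 / 2 : ℝ)) * ENNReal.ofReal (∫ x, ‖F σ x‖ ^ 2) := by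
          rw [ofReal_integral_eq_lintegral_ofReal IΔ' (ae_of_all _ fun x => by positivity)]
      _ ≤ ENNReal.ofReal (σ ^ (1 / 2 : ℝ)) * ENNReal.ofReal (72 * σ⁻¹ * D) := by gcongr
      _ = ENNReal.ofReal (72 * D * σ ^ (-(1 / 2 : ℝ))) := by
          rw [← ENNReal.ofReal_mul (Real.rpow_nonneg hσ0.le _)]
          congr 1
          rw [show σ⁻¹ = σ ^ (-(1 : ℝ)) from (Real.rpow_neg_one σ).symm, show (-(1 / 2 : ℝ)) = 1 / 2 + -(1 : ℝ) by norm_num,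
            Real.rpow_add hσ0]
          ring
  have hIc : IntegrableOn (fun σ : ℝ => 72 * D * σ ^ (-(1 / 2 : ℝ))) (Ioc a t) := IA.const_mul (72 * D)
  have hT : ∫⁻ x, ENNReal.ofReal (∫ σ in Ioc a t, σ ^ (1 / 2 : ℝ) * ‖F σ x‖ ^ 2) ≤ ENNReal.ofReal (72 * D * A) := by
    calc ∫⁻ x, ENNReal.ofReal (∫ σ in Ioc a t, σ ^ (1 / 2 : ℝ) * ‖F σ x‖ ^ 2)
        = ∫⁻ x, ∫⁻ σ in Ioc a t, ENNReal.ofReal (σ ^ (1 / 2 : ℝ) * ‖F σ x‖ ^ 2) :=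
          lintegral_congr fun x => ofReal_integral_eq_lintegral_ofReal (hG_int x)
            ((ae_restrict_iff' measurableSet_Ioc).2 (ae_of_all _ fun σ hσ =>
              mul_nonneg (Real.rpow_nonneg (by linarith [hσ.1]) _) (sq_nonneg _)))
      _ = ∫⁻ σ in Ioc a t, ∫⁻ x, ENNReal.ofReal (σ ^ (1 / 2 : ℝ) * ‖F σ x‖ ^ 2) := lintegral_lintegral_swap hmeas
      _ ≤ ∫⁻ σ in Ioc a t, ENNReal.ofReal (72 * D * σ ^ (-(1 / 2 : ℝ))) :=
          lintegral_mono_ae ((ae_restrict_iff' measurableSet_Ioc).2 (ae_of_all _ hinner))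
      _ = ENNReal.ofReal (∫ σ in Ioc a t, 72 * D * σ ^ (-(1 / 2 : ℝ))) :=
          (ofReal_integral_eq_lintegral_ofReal hIc ((ae_restrict_iff' measurableSet_Ioc).2 (ae_of_all _ fun σ hσ =>
            mul_nonneg (by positivity) (Real.rpow_nonneg (by linarith [hσ.1]) _)))).symm
      _ = ENNReal.ofReal (72 * D * A) := by rw [integral_const_mul]
  -- (4) assemble in `ℝ≥0∞`, then back to the Bochner integral
  have hI : Integrable (fun x => ‖heatExtension g t x - heatExtension g a x‖ ^ 2) :=
    integrable_norm_sq_of_memLp_two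
      ((memLp_heatExtension_holds (E := EuclideanSpace ℝ (Fin 3)) (F := EuclideanSpace ℝ (Fin 3)) hg2 one_le_two ht).sub
        (memLp_heatExtension_holds (E := EuclideanSpace ℝ (Fin 3)) (F := EuclideanSpace ℝ (Fin 3)) hg2 one_le_two ha))
  have hL : ∫⁻ x, ENNReal.ofReal (‖heatExtension g t x - heatExtension g a x‖ ^ 2) ≤ ENNReal.ofReal (288 * t * D) := by
    calc ∫⁻ x, ENNReal.ofReal (‖heatExtension g t x - heatExtension g a x‖ ^ 2)
        ≤ ∫⁻ x, ENNReal.ofReal A * ENNReal.ofReal (∫ σ in Ioc a t, σ ^ (1 / 2 : ℝ) * ‖F σ x‖ ^ 2) :=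
          lintegral_mono fun x => by
            rw [← ENNReal.ofReal_mul hA0]; exact ENNReal.ofReal_le_ofReal (hCS x)
      _ = ENNReal.ofReal A * ∫⁻ x, ENNReal.ofReal (∫ σ in Ioc a t, σ ^ (1 / 2 : ℝ) * ‖F σ x‖ ^ 2) :=
          lintegral_const_mul' _ _ ENNReal.ofReal_ne_top
      _ ≤ ENNReal.ofReal A * ENNReal.ofReal (72 * D * A) := by gcongr
      _ = ENNReal.ofReal (72 * D * A ^ 2) := by rw [← ENNReal.ofReal_mul hA0]; ring_nf
      _ ≤ ENNReal.ofReal (288 * t * D) := by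
          refine ENNReal.ofReal_le_ofReal ?_
          have hA2 : A ^ 2 ≤ (2 * Real.sqrt t) ^ 2 := pow_le_pow_left₀ hA0 hA 2
          rw [mul_pow, Real.sq_sqrt ht.le] at hA2
          nlinarith [hD0, hA2]
  rw [integral_eq_lintegral_of_nonneg_ae (ae_of_all _ fun x => by positivity) hI.aestronglyMeasurable]
  have h := ENNReal.toReal_mono ENNReal.ofReal_ne_top hL
  rwa [ENNReal.toReal_ofReal (by positivity)] at h

/-- **`NearSaturationNearMaximiser` (stmt-25482) from the identification of the limit profile ALONE, BY NAME.** Every d-free clause of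
the concentration-compactness hypothesis is now proved in the tree (vanishing/dichotomy/centring, Pythagoras, splitting, weak pairings,
linear and quadratic mixed terms, density upgrades, sequential Banach–Alaoglu, local Rellich via the heat semigroup). Assumed: (I) — for
the sharp constant, the weak-limit velocity gradient `M_j` and the local vorticity limit `Ω` of a centred normalised maximising
subsequence are `∂ⱼw`, `curl w` of one ADMISSIBLE `w` (existence, regularity and decay of the Lu–Doering extremising profile). [folklore] -/
theorem nearSaturationNearMaximiser_of_identification
    (HI : ∀ c : ℝ, (0 < c ∧ (∀ v : EuclideanSpace ℝ (Fin 3) → EuclideanSpace ℝ (Fin 3), (ContDiff ℝ (⊤ : ℕ∞) v ∧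
      Literature.Analysis.FluidPDE.VectorCalculus.IsDivFree v ∧ (∫⁻ x, ‖iteratedFDeriv ℝ 0 v x‖ₑ ^ 2 < ⊤) ∧
      (∫⁻ x, ‖iteratedFDeriv ℝ 1 v x‖ₑ ^ 2 < ⊤) ∧ (∫⁻ x, ‖iteratedFDeriv ℝ 2 v x‖ₑ ^ 2 < ⊤)) → (∫ x,
      ⟪Literature.Analysis.FluidPDE.curl v x, fderiv ℝ v x (Literature.Analysis.FluidPDE.curl v x)⟫_ℝ) ≤ c *
      (∫ x, ‖Literature.Analysis.FluidPDE.curl v x‖ ^ 2) ^ (3 / 4 : ℝ) * (∫ x,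
      Literature.Analysis.FluidPDE.frobeniusNormSq (fderiv ℝ (Literature.Analysis.FluidPDE.curl v) x)) ^ (3 / 4 : ℝ)) ∧ ∀ c' : ℝ, (∀ w : EuclideanSpace ℝ (Fin 3) → EuclideanSpace ℝ (Fin 3), (ContDiff ℝ (⊤ : ℕ∞) w ∧
      Literature.Analysis.FluidPDE.VectorCalculus.IsDivFree w ∧ (∫⁻ x, ‖iteratedFDeriv ℝ 0 w x‖ₑ ^ 2 < ⊤) ∧
      (∫⁻ x, ‖iteratedFDeriv ℝ 1 w x‖ₑ ^ 2 < ⊤) ∧ (∫⁻ x, ‖iteratedFDeriv ℝ 2 w x‖ₑ ^ 2 < ⊤)) → (∫ x,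
      ⟪Literature.Analysis.FluidPDE.curl w x, fderiv ℝ w x (Literature.Analysis.FluidPDE.curl w x)⟫_ℝ) ≤ c' *
      (∫ x, ‖Literature.Analysis.FluidPDE.curl w x‖ ^ 2) ^ (3 / 4 : ℝ) * (∫ x,
      Literature.Analysis.FluidPDE.frobeniusNormSq (fderiv ℝ (Literature.Analysis.FluidPDE.curl w) x)) ^ (3 / 4 : ℝ)) → c ≤ c') →
      ∀ K δ : ℝ, 0 < K → 0 < δ → ∀ v : ℕ → EuclideanSpace ℝ (Fin 3) → EuclideanSpace ℝ (Fin 3),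
      (∀ n, (ContDiff ℝ (⊤ : ℕ∞) (v n) ∧
      Literature.Analysis.FluidPDE.VectorCalculus.IsDivFree (v n) ∧ (∫⁻ x, ‖iteratedFDeriv ℝ 0 (v n) x‖ₑ ^ 2 < ⊤) ∧
      (∫⁻ x, ‖iteratedFDeriv ℝ 1 (v n) x‖ₑ ^ 2 < ⊤) ∧ (∫⁻ x, ‖iteratedFDeriv ℝ 2 (v n) x‖ₑ ^ 2 < ⊤))) →
      (∀ n, (∫ x, ‖Literature.Analysis.FluidPDE.curl (v n) x‖ ^ 2) = 1) →
      (∀ n, (∫ x, Literature.Analysis.FluidPDE.frobeniusNormSq (fderiv ℝ (Literature.Analysis.FluidPDE.curl (v n)) x)) = 1) →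
      Tendsto (fun n => ∫ x, ⟪Literature.Analysis.FluidPDE.curl (v n) x, fderiv ℝ (v n) x
        (Literature.Analysis.FluidPDE.curl (v n) x)⟫_ℝ) atTop (𝓝 c) →
      (∀ᶠ n in atTop, δ ≤ ∫ x in Metric.ball (0 : EuclideanSpace ℝ (Fin 3)) K, ‖Literature.Analysis.FluidPDE.curl (v n) x‖ ^ 2) →
      ∀ (φ₀ : ℕ → ℕ) (M : Fin 3 → EuclideanSpace ℝ (Fin 3) → EuclideanSpace ℝ (Fin 3))
        (Ω : EuclideanSpace ℝ (Fin 3) → EuclideanSpace ℝ (Fin 3)), StrictMono φ₀ →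
      (∀ j, MemLp (M j) 2 volume) →
      (∀ (j : Fin 3) (ψ : EuclideanSpace ℝ (Fin 3) → EuclideanSpace ℝ (Fin 3)), MemLp ψ 2 volume →
        Tendsto (fun k => ∫ x, ⟪fderiv ℝ (v (φ₀ k)) x (EuclideanSpace.basisFun (Fin 3) ℝ j), ψ x⟫_ℝ) atTop
          (𝓝 (∫ x, ⟪M j x, ψ x⟫_ℝ))) →
      MemLp Ω 2 volume →
      (∀ R : ℝ, 0 < R → Tendsto (fun k => ∫ x in Metric.ball (0 : EuclideanSpace ℝ (Fin 3)) R,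
          ‖Literature.Analysis.FluidPDE.curl (v (φ₀ k)) x - Ω x‖ ^ 2) atTop (𝓝 0)) →
      ∃ w : EuclideanSpace ℝ (Fin 3) → EuclideanSpace ℝ (Fin 3), (ContDiff ℝ (⊤ : ℕ∞) w ∧
      Literature.Analysis.FluidPDE.VectorCalculus.IsDivFree w ∧ (∫⁻ x, ‖iteratedFDeriv ℝ 0 w x‖ₑ ^ 2 < ⊤) ∧
      (∫⁻ x, ‖iteratedFDeriv ℝ 1 w x‖ₑ ^ 2 < ⊤) ∧ (∫⁻ x, ‖iteratedFDeriv ℝ 2 w x‖ₑ ^ 2 < ⊤)) ∧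
        (∀ j : Fin 3, (fun x => fderiv ℝ w x (EuclideanSpace.basisFun (Fin 3) ℝ j)) =ᵐ[volume] M j) ∧
        Literature.Analysis.FluidPDE.curl w =ᵐ[volume] Ω) :
    Summit.NavierStokesRegularity.NavierStokesRegularity.Theses.EfficiencyFloor.NearSaturationNearMaximiser :=
  nearSaturationNearMaximiser_of_uniformMollification_of_identification
    ⟨288, fun _ hg I2 ID _ _ ha hat => uniform_mollification_bound hg I2 ID ha hat⟩ HI

end SeqCore

end NearSaturationNearMaximiser

end Summit.NavierStokesRegularity.NavierStokesRegularity.Theorems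

end
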